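import Summits.BirchSwinnertonDyer.BirchSwinnertonDyer.Theorems.ByReductionTypeAtTwoTowerClassKitB
import Summits.BirchSwinnertonDyer.BirchSwinnertonDyer.Theorems.ByReductionTypeAtTwoTowerFiltrationClasses
import HarnessLib

/-!
# Route `ByReductionTypeAtTwo`, item `OrdKatoHalfAtTwo` (stmt-BirchSwinnertonDyer-19271): the GOOD-ORDINARY tower road in the
# EXACT «A-currency» — the item AT `W`, `MissingUpperBoundAt W 2`, `BSDp W 2`, `MazurMainConjecture W 2` at an `E[2]`-irreducible
# good-ordinary-at-2 curve from ONE window of the `(σ−1)`-filtration of the RELAXED layer group `A_n[2]`, with NO local interface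
# and NO local constant (seat bsd-2adic-tower-1 GEN 13)

HONEST FRAMING (cell `bsd-2adic`, run/shared/lean/pub/bsd-2adic/, HUMAN RULINGS D-0036/D-0054/D-0074): door THEOREMS only; no
definition, no new named fact, no `sorry`; they close no item by themselves; nothing is booked; BSD is not proved by any of this.
PARTITION: X5@2 GOOD-ORDINARY TOWER rows (K4, O1; item 19271; the `E[2]`-irreducible block) × p = 2 — types-the-object-of (the W-level
composition class files instantiate in five lines per member); closes none.

WHAT. The σ-window analogue of KitB (`TowerClass.…_of_towerGap_of_abbesUllmo`, ord-2) fed by GEN 13's exact gap doors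
`TowerFiltration.towerGapAtTwo_of_filtration_classCounts{,_upper}` (p571615): certificates = two filtered counts at ONE layer `n`,
`m + k ≤ 2ⁿ`, the upper one (or both) read off `A_n[2] = h_n⁻¹(Sel_{2^∞}(E/ℚ_∞))[2]` (`#X/(2,T^m)X` EXACTLY, mult-2's
`natCard_quotient_towerIdeal_eq_natCard_layerFiltration`), and `d + 1 ≤ k + a`; NO `S`/`P`, NO `C_v`, NO `h0`/`hC`, NO `hS34`/`hM`/`h33g`/`hA`.
At good-ordinary 2 the induced counts are ENGINE A's `e_j`/`eind` of record (CERT-TOWER-E1 §1, countersign B1); the σ-pieces of the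
induced group are the same linear algebra as mult-2's `sel2sigma` pieces (ask (A1) of `tower/NOTE-B1-MULT-GEN13.md`). DISPLAYED, NOT
PROVED: PRINT {`h17` Kato 17.4, `hAU` Abbes–Ullmo, and for the `Ш`-currency doors `hEC`, `hmod`, `hGZK`} + CERT {`hr`, the two counts, `had`,
(`hsha`)} — the binders of the `_kernel` doors (GEN 11) minus nothing, the local certificate legs GONE. The mult twin is
`…MultUpperHalfTowerAcur` (p572550). Planner record: the open good-ordinary residue (OPEN65) is λ-saturated in the e-currency at layers ≤ 3
(RC-139) — these doors are the format for σ-windows at layer 4, not a claim that a layer-≤3 window exists there.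

References: R. Greenberg, LNM 1716 (1999) §1 p. 60, §2 Prop. 2.4, §3 pp. 85–90, Thm. 4.1; K. Kato, Astérisque 295 (2004) Thm. 17.4;
A. Abbes, E. Ullmo, Compositio Math. 103 (1996) Thm. A; R. L. Miller, LMS J. Comput. Math. 14 (2011) Def. 1.1.
-/

set_option autoImplicit false
-- the Theorems namespace of this sub repeats the summit name by design (D-0017 nested layout: Summit.<S>.<Sub>)
set_option linter.dupNamespace false

noncomputable section

open scoped Classical MatrixGroups ModularForm

open NumberField IsDedekindDomain CongruenceSubgroup WeierstrassCurve Literature.NumberTheory.EllipticCurves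
  Literature.NumberTheory.EllipticCurves.ModularForms Literature.NumberTheory.EllipticCurves.Rank1Residual
  Literature.NumberTheory.EllipticCurves.Rank1Residual.Typed
  Literature.NumberTheory.EllipticCurves.Greenberg1999
  Summit.BirchSwinnertonDyer.Rank1Residual.X5 Summit.BirchSwinnertonDyer.Rank1Residual.X5.O1
  Summit.BirchSwinnertonDyer.BirchSwinnertonDyer.Theorems.KatoHalfPinch
  Summit.BirchSwinnertonDyer.BirchSwinnertonDyer.Theorems.Rank1ResidualX1Defs

namespace Summit.BirchSwinnertonDyer.BirchSwinnertonDyer.Theorems.GoodOrdAcur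

section Curve

variable (W : WeierstrassCurve ℚ) [W.IsElliptic] [W.IsGloballyMinimal]

/-- **The Kato–Néron half AT `W` (item `OrdKatoHalfAtTwo` 19271 at `W`) from ONE A-currency σ-window** (HYBRID counts: lower classical σ-piece, upper induced σ-piece;
`m + k ≤ 2ⁿ`, `d + 1 ≤ k + a`): PRINT {`h17`, `hAU`} + kernel {`GoodOrd W 2`, `Irr W 2`}; NO local interface, NO local constant.
[cite: Kato2004Asterisque, Thm. 17.4 (1)(2) (p. 273)] [cite: AbbesUllmo1996, Thm. A] [cite: GreenbergLNM1716, §1 p. 60 and §3 pp. 85–86] -/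
theorem mainConjectureLowerDivisibilityAtTwoOrd_of_filtration_classCounts_upper
    (h17 : ∀ [NeZero (W.conductorNorm ℤ)] (f : CuspForm (Gamma0 (W.conductorNorm ℤ)) 2),
      kato_divisibility_allPrimes W 2 (f := f))
    (hAU : abbesUllmo_not_dvd_maninConstant_of_not_dvd_level) (hgo : GoodOrd W 2) (hirr : Irr W 2)
    {n m k a d : ℕ} (hmk : m + k ≤ 2 ^ n)
    (hlow : ∀ (κ : ZpExtension ℚ 2) (γ : Field.absoluteGaloisGroup ℚ), κ.IsCyclotomic →
      κ.IsTopGenerator γ →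
        2 ^ a ≤ Nat.card {z : W.selmerLayer κ n // 2 • z = 0 ∧
          (⇑(W.conjH1 2 (κ.layerSubgroup n) γ -
            AddMonoidHom.id (W.subgroupH1 2 (κ.layerSubgroup n))))^[m]
            (z : W.subgroupH1 2 (κ.layerSubgroup n)) = 0})
    (hup : ∀ (κ : ZpExtension ℚ 2) (γ : Field.absoluteGaloisGroup ℚ), κ.IsCyclotomic →
      κ.IsTopGenerator γ →
        Nat.card {z : W.selmerInftyPreimage κ n // 2 • z = 0 ∧
          (⇑(W.conjH1 2 (κ.layerSubgroup n) γ -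
            AddMonoidHom.id (W.subgroupH1 2 (κ.layerSubgroup n))))^[m + k]
            (z : W.subgroupH1 2 (κ.layerSubgroup n)) = 0} ≤ 2 ^ d)
    (had : d + 1 ≤ k + a) : MainConjectureLowerDivisibilityAtTwoOrd W :=
  TowerClass.mainConjectureLowerDivisibilityAtTwoOrd_of_towerGap_of_abbesUllmo W h17 hAU hgo hirr
    (TowerFiltration.towerGapAtTwo_of_filtration_classCounts_upper W
      (TowerClass.not_two_dvd_torsionOrder_of_irr W hirr) hmk hlow hup (by omega))

/-- **The UPPER half `MissingUpperBoundAt W 2` from ONE A-currency σ-window** (HYBRID counts: lower classical σ-piece, upper induced σ-piece), analytic rank `0`: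
PRINT {`hEC`, `hmod`, `hGZK`, `h17`, `hAU`} + CERT {`hr`, `hlow`, `hup`, `had`}. [cite: GreenbergLNM1716, Thm. 4.1 (p. 102)]
[cite: Kato2004Asterisque, Thm. 17.4 (1)(2) (p. 273)] -/
theorem missingUpperBoundAt_two_of_filtration_classCounts_upper
    (hEC : TwoAdicEulerCharRankZero W 0)
    (hmod : nonempty_modularParametrizationData) (hGZK : rank_eq_analyticRank_of_analyticRank_le_one)
    (h17 : ∀ [NeZero (W.conductorNorm ℤ)] (f : CuspForm (Gamma0 (W.conductorNorm ℤ)) 2),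
      kato_divisibility_allPrimes W 2 (f := f))
    (hAU : abbesUllmo_not_dvd_maninConstant_of_not_dvd_level) (hgo : GoodOrd W 2) (hirr : Irr W 2)
    (hr : W.analyticRank = 0)
    {n m k a d : ℕ} (hmk : m + k ≤ 2 ^ n)
    (hlow : ∀ (κ : ZpExtension ℚ 2) (γ : Field.absoluteGaloisGroup ℚ), κ.IsCyclotomic →
      κ.IsTopGenerator γ →
        2 ^ a ≤ Nat.card {z : W.selmerLayer κ n // 2 • z = 0 ∧
          (⇑(W.conjH1 2 (κ.layerSubgroup n) γ -
            AddMonoidHom.id (W.subgroupH1 2 (κ.layerSubgroup n))))^[m]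
            (z : W.subgroupH1 2 (κ.layerSubgroup n)) = 0})
    (hup : ∀ (κ : ZpExtension ℚ 2) (γ : Field.absoluteGaloisGroup ℚ), κ.IsCyclotomic →
      κ.IsTopGenerator γ →
        Nat.card {z : W.selmerInftyPreimage κ n // 2 • z = 0 ∧
          (⇑(W.conjH1 2 (κ.layerSubgroup n) γ -
            AddMonoidHom.id (W.subgroupH1 2 (κ.layerSubgroup n))))^[m + k]
            (z : W.subgroupH1 2 (κ.layerSubgroup n)) = 0} ≤ 2 ^ d)
    (had : d + 1 ≤ k + a) : MissingUpperBoundAt W 2 :=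
  TowerClass.missingUpperBoundAt_two_of_towerGap_of_abbesUllmo W hEC hmod hGZK h17 hAU hgo hirr hr
    (TowerFiltration.towerGapAtTwo_of_filtration_classCounts_upper W
      (TowerClass.not_two_dvd_torsionOrder_of_irr W hirr) hmk hlow hup (by omega))

/-- **`BSD(W,2)` from ONE A-currency σ-window** (HYBRID counts: lower classical σ-piece, upper induced σ-piece) + the descent inequality `hsha : MissingLowerBoundAt W 2`:
PRINT {`hEC`, `hmod`, `hGZK`, `h17`, `hAU`} + CERT {`hr`, `hlow`, `hup`, `had`, `hsha`}. [cite: Miller2011LMS, Def. 1.1]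
[cite: GreenbergLNM1716, Thm. 4.1 (p. 102)] [cite: Kato2004Asterisque, Thm. 17.4 (1)(2) (p. 273)] -/
theorem bsdp_two_of_filtration_classCounts_upper
    (hEC : TwoAdicEulerCharRankZero W 0)
    (hmod : nonempty_modularParametrizationData) (hGZK : rank_eq_analyticRank_of_analyticRank_le_one)
    (h17 : ∀ [NeZero (W.conductorNorm ℤ)] (f : CuspForm (Gamma0 (W.conductorNorm ℤ)) 2),
      kato_divisibility_allPrimes W 2 (f := f))
    (hAU : abbesUllmo_not_dvd_maninConstant_of_not_dvd_level) (hgo : GoodOrd W 2) (hirr : Irr W 2)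
    (hr : W.analyticRank = 0)
    {n m k a d : ℕ} (hmk : m + k ≤ 2 ^ n)
    (hlow : ∀ (κ : ZpExtension ℚ 2) (γ : Field.absoluteGaloisGroup ℚ), κ.IsCyclotomic →
      κ.IsTopGenerator γ →
        2 ^ a ≤ Nat.card {z : W.selmerLayer κ n // 2 • z = 0 ∧
          (⇑(W.conjH1 2 (κ.layerSubgroup n) γ -
            AddMonoidHom.id (W.subgroupH1 2 (κ.layerSubgroup n))))^[m]
            (z : W.subgroupH1 2 (κ.layerSubgroup n)) = 0})
    (hup : ∀ (κ : ZpExtension ℚ 2) (γ : Field.absoluteGaloisGroup ℚ), κ.IsCyclotomic →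
      κ.IsTopGenerator γ →
        Nat.card {z : W.selmerInftyPreimage κ n // 2 • z = 0 ∧
          (⇑(W.conjH1 2 (κ.layerSubgroup n) γ -
            AddMonoidHom.id (W.subgroupH1 2 (κ.layerSubgroup n))))^[m + k]
            (z : W.subgroupH1 2 (κ.layerSubgroup n)) = 0} ≤ 2 ^ d)
    (had : d + 1 ≤ k + a) (hsha : MissingLowerBoundAt W 2) : BSDp W 2 :=
  TowerClass.bsdp_two_of_towerGap_of_abbesUllmo W hEC hmod hGZK h17 hAU hgo hirr hr
    (TowerFiltration.towerGapAtTwo_of_filtration_classCounts_upper W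
      (TowerClass.not_two_dvd_torsionOrder_of_irr W hirr) hmk hlow hup (by omega)) hsha

/-- **The `2`-adic IMC `MazurMainConjecture W 2` from ONE A-currency σ-window** (HYBRID counts: lower classical σ-piece, upper induced σ-piece) + `hsha`, same binders.
[cite: Kato2004Asterisque, Thm. 17.4 (1)(2) (p. 273)] [cite: GreenbergLNM1716, Thm. 4.1 (p. 102)] [cite: Washington1997, §13.2] -/
theorem mazurMainConjecture_two_of_filtration_classCounts_upper
    (hEC : TwoAdicEulerCharRankZero W 0)
    (hmod : nonempty_modularParametrizationData) (hGZK : rank_eq_analyticRank_of_analyticRank_le_one)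
    (h17 : ∀ [NeZero (W.conductorNorm ℤ)] (f : CuspForm (Gamma0 (W.conductorNorm ℤ)) 2),
      kato_divisibility_allPrimes W 2 (f := f))
    (hAU : abbesUllmo_not_dvd_maninConstant_of_not_dvd_level) (hgo : GoodOrd W 2) (hirr : Irr W 2)
    (hr : W.analyticRank = 0)
    {n m k a d : ℕ} (hmk : m + k ≤ 2 ^ n)
    (hlow : ∀ (κ : ZpExtension ℚ 2) (γ : Field.absoluteGaloisGroup ℚ), κ.IsCyclotomic →
      κ.IsTopGenerator γ →
        2 ^ a ≤ Nat.card {z : W.selmerLayer κ n // 2 • z = 0 ∧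
          (⇑(W.conjH1 2 (κ.layerSubgroup n) γ -
            AddMonoidHom.id (W.subgroupH1 2 (κ.layerSubgroup n))))^[m]
            (z : W.subgroupH1 2 (κ.layerSubgroup n)) = 0})
    (hup : ∀ (κ : ZpExtension ℚ 2) (γ : Field.absoluteGaloisGroup ℚ), κ.IsCyclotomic →
      κ.IsTopGenerator γ →
        Nat.card {z : W.selmerInftyPreimage κ n // 2 • z = 0 ∧
          (⇑(W.conjH1 2 (κ.layerSubgroup n) γ -
            AddMonoidHom.id (W.subgroupH1 2 (κ.layerSubgroup n))))^[m + k]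
            (z : W.subgroupH1 2 (κ.layerSubgroup n)) = 0} ≤ 2 ^ d)
    (had : d + 1 ≤ k + a) (hsha : MissingLowerBoundAt W 2) : MazurMainConjecture W 2 :=
  TowerClass.mazurMainConjecture_two_of_towerGap_of_abbesUllmo W hEC hmod hGZK h17 hAU hgo hirr hr
    (TowerFiltration.towerGapAtTwo_of_filtration_classCounts_upper W
      (TowerClass.not_two_dvd_torsionOrder_of_irr W hirr) hmk hlow hup (by omega)) hsha

/-- **The Kato–Néron half AT `W` (item `OrdKatoHalfAtTwo` 19271 at `W`) from ONE A-currency σ-window** (BOTH counts induced;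
`m + k ≤ 2ⁿ`, `d + 1 ≤ k + a`): PRINT {`h17`, `hAU`} + kernel {`GoodOrd W 2`, `Irr W 2`}; NO local interface, NO local constant.
[cite: Kato2004Asterisque, Thm. 17.4 (1)(2) (p. 273)] [cite: AbbesUllmo1996, Thm. A] [cite: GreenbergLNM1716, §1 p. 60 and §3 pp. 85–86] -/
theorem mainConjectureLowerDivisibilityAtTwoOrd_of_filtration_classCounts
    (h17 : ∀ [NeZero (W.conductorNorm ℤ)] (f : CuspForm (Gamma0 (W.conductorNorm ℤ)) 2),
      kato_divisibility_allPrimes W 2 (f := f))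
    (hAU : abbesUllmo_not_dvd_maninConstant_of_not_dvd_level) (hgo : GoodOrd W 2) (hirr : Irr W 2)
    {n m k a d : ℕ} (hmk : m + k ≤ 2 ^ n)
    (hlow : ∀ (κ : ZpExtension ℚ 2) (γ : Field.absoluteGaloisGroup ℚ), κ.IsCyclotomic →
      κ.IsTopGenerator γ →
        2 ^ a ≤ Nat.card {z : W.selmerInftyPreimage κ n // 2 • z = 0 ∧
          (⇑(W.conjH1 2 (κ.layerSubgroup n) γ -
            AddMonoidHom.id (W.subgroupH1 2 (κ.layerSubgroup n))))^[m]
            (z : W.subgroupH1 2 (κ.layerSubgroup n)) = 0})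
    (hup : ∀ (κ : ZpExtension ℚ 2) (γ : Field.absoluteGaloisGroup ℚ), κ.IsCyclotomic →
      κ.IsTopGenerator γ →
        Nat.card {z : W.selmerInftyPreimage κ n // 2 • z = 0 ∧
          (⇑(W.conjH1 2 (κ.layerSubgroup n) γ -
            AddMonoidHom.id (W.subgroupH1 2 (κ.layerSubgroup n))))^[m + k]
            (z : W.subgroupH1 2 (κ.layerSubgroup n)) = 0} ≤ 2 ^ d)
    (had : d + 1 ≤ k + a) : MainConjectureLowerDivisibilityAtTwoOrd W :=
  TowerClass.mainConjectureLowerDivisibilityAtTwoOrd_of_towerGap_of_abbesUllmo W h17 hAU hgo hirr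
    (TowerFiltration.towerGapAtTwo_of_filtration_classCounts W
      (TowerClass.not_two_dvd_torsionOrder_of_irr W hirr) hmk hlow hup (by omega))

/-- **The UPPER half `MissingUpperBoundAt W 2` from ONE A-currency σ-window** (BOTH counts induced), analytic rank `0`:
PRINT {`hEC`, `hmod`, `hGZK`, `h17`, `hAU`} + CERT {`hr`, `hlow`, `hup`, `had`}. [cite: GreenbergLNM1716, Thm. 4.1 (p. 102)]
[cite: Kato2004Asterisque, Thm. 17.4 (1)(2) (p. 273)] -/
theorem missingUpperBoundAt_two_of_filtration_classCounts
    (hEC : TwoAdicEulerCharRankZero W 0)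
    (hmod : nonempty_modularParametrizationData) (hGZK : rank_eq_analyticRank_of_analyticRank_le_one)
    (h17 : ∀ [NeZero (W.conductorNorm ℤ)] (f : CuspForm (Gamma0 (W.conductorNorm ℤ)) 2),
      kato_divisibility_allPrimes W 2 (f := f))
    (hAU : abbesUllmo_not_dvd_maninConstant_of_not_dvd_level) (hgo : GoodOrd W 2) (hirr : Irr W 2)
    (hr : W.analyticRank = 0)
    {n m k a d : ℕ} (hmk : m + k ≤ 2 ^ n)
    (hlow : ∀ (κ : ZpExtension ℚ 2) (γ : Field.absoluteGaloisGroup ℚ), κ.IsCyclotomic →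
      κ.IsTopGenerator γ →
        2 ^ a ≤ Nat.card {z : W.selmerInftyPreimage κ n // 2 • z = 0 ∧
          (⇑(W.conjH1 2 (κ.layerSubgroup n) γ -
            AddMonoidHom.id (W.subgroupH1 2 (κ.layerSubgroup n))))^[m]
            (z : W.subgroupH1 2 (κ.layerSubgroup n)) = 0})
    (hup : ∀ (κ : ZpExtension ℚ 2) (γ : Field.absoluteGaloisGroup ℚ), κ.IsCyclotomic →
      κ.IsTopGenerator γ →
        Nat.card {z : W.selmerInftyPreimage κ n // 2 • z = 0 ∧
          (⇑(W.conjH1 2 (κ.layerSubgroup n) γ -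
            AddMonoidHom.id (W.subgroupH1 2 (κ.layerSubgroup n))))^[m + k]
            (z : W.subgroupH1 2 (κ.layerSubgroup n)) = 0} ≤ 2 ^ d)
    (had : d + 1 ≤ k + a) : MissingUpperBoundAt W 2 :=
  TowerClass.missingUpperBoundAt_two_of_towerGap_of_abbesUllmo W hEC hmod hGZK h17 hAU hgo hirr hr
    (TowerFiltration.towerGapAtTwo_of_filtration_classCounts W
      (TowerClass.not_two_dvd_torsionOrder_of_irr W hirr) hmk hlow hup (by omega))

/-- **`BSD(W,2)` from ONE A-currency σ-window** (BOTH counts induced) + the descent inequality `hsha : MissingLowerBoundAt W 2`: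
PRINT {`hEC`, `hmod`, `hGZK`, `h17`, `hAU`} + CERT {`hr`, `hlow`, `hup`, `had`, `hsha`}. [cite: Miller2011LMS, Def. 1.1]
[cite: GreenbergLNM1716, Thm. 4.1 (p. 102)] [cite: Kato2004Asterisque, Thm. 17.4 (1)(2) (p. 273)] -/
theorem bsdp_two_of_filtration_classCounts
    (hEC : TwoAdicEulerCharRankZero W 0)
    (hmod : nonempty_modularParametrizationData) (hGZK : rank_eq_analyticRank_of_analyticRank_le_one)
    (h17 : ∀ [NeZero (W.conductorNorm ℤ)] (f : CuspForm (Gamma0 (W.conductorNorm ℤ)) 2),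
      kato_divisibility_allPrimes W 2 (f := f))
    (hAU : abbesUllmo_not_dvd_maninConstant_of_not_dvd_level) (hgo : GoodOrd W 2) (hirr : Irr W 2)
    (hr : W.analyticRank = 0)
    {n m k a d : ℕ} (hmk : m + k ≤ 2 ^ n)
    (hlow : ∀ (κ : ZpExtension ℚ 2) (γ : Field.absoluteGaloisGroup ℚ), κ.IsCyclotomic →
      κ.IsTopGenerator γ →
        2 ^ a ≤ Nat.card {z : W.selmerInftyPreimage κ n // 2 • z = 0 ∧
          (⇑(W.conjH1 2 (κ.layerSubgroup n) γ -
            AddMonoidHom.id (W.subgroupH1 2 (κ.layerSubgroup n))))^[m]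
            (z : W.subgroupH1 2 (κ.layerSubgroup n)) = 0})
    (hup : ∀ (κ : ZpExtension ℚ 2) (γ : Field.absoluteGaloisGroup ℚ), κ.IsCyclotomic →
      κ.IsTopGenerator γ →
        Nat.card {z : W.selmerInftyPreimage κ n // 2 • z = 0 ∧
          (⇑(W.conjH1 2 (κ.layerSubgroup n) γ -
            AddMonoidHom.id (W.subgroupH1 2 (κ.layerSubgroup n))))^[m + k]
            (z : W.subgroupH1 2 (κ.layerSubgroup n)) = 0} ≤ 2 ^ d)
    (had : d + 1 ≤ k + a) (hsha : MissingLowerBoundAt W 2) : BSDp W 2 :=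
  TowerClass.bsdp_two_of_towerGap_of_abbesUllmo W hEC hmod hGZK h17 hAU hgo hirr hr
    (TowerFiltration.towerGapAtTwo_of_filtration_classCounts W
      (TowerClass.not_two_dvd_torsionOrder_of_irr W hirr) hmk hlow hup (by omega)) hsha

/-- **The `2`-adic IMC `MazurMainConjecture W 2` from ONE A-currency σ-window** (BOTH counts induced) + `hsha`, same binders.
[cite: Kato2004Asterisque, Thm. 17.4 (1)(2) (p. 273)] [cite: GreenbergLNM1716, Thm. 4.1 (p. 102)] [cite: Washington1997, §13.2] -/
theorem mazurMainConjecture_two_of_filtration_classCounts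
    (hEC : TwoAdicEulerCharRankZero W 0)
    (hmod : nonempty_modularParametrizationData) (hGZK : rank_eq_analyticRank_of_analyticRank_le_one)
    (h17 : ∀ [NeZero (W.conductorNorm ℤ)] (f : CuspForm (Gamma0 (W.conductorNorm ℤ)) 2),
      kato_divisibility_allPrimes W 2 (f := f))
    (hAU : abbesUllmo_not_dvd_maninConstant_of_not_dvd_level) (hgo : GoodOrd W 2) (hirr : Irr W 2)
    (hr : W.analyticRank = 0)
    {n m k a d : ℕ} (hmk : m + k ≤ 2 ^ n)
    (hlow : ∀ (κ : ZpExtension ℚ 2) (γ : Field.absoluteGaloisGroup ℚ), κ.IsCyclotomic →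
      κ.IsTopGenerator γ →
        2 ^ a ≤ Nat.card {z : W.selmerInftyPreimage κ n // 2 • z = 0 ∧
          (⇑(W.conjH1 2 (κ.layerSubgroup n) γ -
            AddMonoidHom.id (W.subgroupH1 2 (κ.layerSubgroup n))))^[m]
            (z : W.subgroupH1 2 (κ.layerSubgroup n)) = 0})
    (hup : ∀ (κ : ZpExtension ℚ 2) (γ : Field.absoluteGaloisGroup ℚ), κ.IsCyclotomic →
      κ.IsTopGenerator γ →
        Nat.card {z : W.selmerInftyPreimage κ n // 2 • z = 0 ∧
          (⇑(W.conjH1 2 (κ.layerSubgroup n) γ -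
            AddMonoidHom.id (W.subgroupH1 2 (κ.layerSubgroup n))))^[m + k]
            (z : W.subgroupH1 2 (κ.layerSubgroup n)) = 0} ≤ 2 ^ d)
    (had : d + 1 ≤ k + a) (hsha : MissingLowerBoundAt W 2) : MazurMainConjecture W 2 :=
  TowerClass.mazurMainConjecture_two_of_towerGap_of_abbesUllmo W hEC hmod hGZK h17 hAU hgo hirr hr
    (TowerFiltration.towerGapAtTwo_of_filtration_classCounts W
      (TowerClass.not_two_dvd_torsionOrder_of_irr W hirr) hmk hlow hup (by omega)) hsha

end Curve

end Summit.BirchSwinnertonDyer.BirchSwinnertonDyer.Theorems.GoodOrdAcur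

end
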